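import Summits.AtomisticToContinuum.Crystallization.Theses.GappedShellCensus
import Summits.AtomisticToContinuum.Crystallization.Theses.PhononSlackCertificates
import Summits.AtomisticToContinuum.Crystallization.Theorems.RadialDefectsVanish.Negative.FalseWithoutGS
import Summits.AtomisticToContinuum.Crystallization.Theorems.ChargedEnergyGap.Negative.Unconditional

/-!
# Crux-ideate sketch for `GappedShellCensus.RadialDefectsVanish` (stmt-AtomisticToContinuum-15930)

First-lemma signatures of the three idea cards (ideator 1, round 1).  Everything is a `def … : Prop`
over existing declarations (no new axioms, no sorry); the cards cite these by name.

* Card A `layered-scale-lock`      : `LayeredMatched`, `siteExcess`, `LayeredScaleLock`, `BridgeA`.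
* Card B `radial-torus-rigidity`   : `IsGappedTwelveSet`, `RadialTorusRigidity`, `VacuumPeriodisation`, `BridgeB`.
* Card C `mean-shell-rounding`     : `StrongThirteenThick`, `MeanShellRounding`, `AveragedRadialProfile`, `BridgeC`.
-/

noncomputable section

namespace Summit.AtomisticToContinuum.Crystallization.Cruxes.RadialDefectsVanish.IdeatorOne

open scoped BigOperators Classical
open Literature.MathematicalPhysics.StatisticalMechanics Literature.Geometry.DiscreteGeometry
open Summit.AtomisticToContinuum.Crystallization.Theses.GappedShellCensus
open Summit.AtomisticToContinuum.Crystallization.Theses.PhononSlackCertificates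
open Summit.AtomisticToContinuum.Crystallization.Theorems.RadialDefectsVanish.Negative

local notation "E3" => EuclideanSpace ℝ (Fin 3)

/-- The periodic infimum `e* = ⨅_Q e(Q)` (spelled as in `CoerciveTwoShellGap`). -/
def eStar' : ℝ := ⨅ Q : PeriodicConfiguration 3, Q.energyPerParticle lennardJones

/-- Half site energy minus `e*`:  `e_i − e* = ½ Σ_{j ≠ i} V(|x_i − x_j|) − e*`. -/
def siteExcess {N : ℕ} (x : Fin N → E3) (i : Fin N) : ℝ :=
  (1 / 2 : ℝ) * (∑ j ∈ Finset.univ.erase i, lennardJones (dist (x i) (x j))) - eStar'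

/-- Single-configuration reading of the landed `IsGappedTwelveAt` (which takes the whole sequence):
site `i` of `x : Fin N → ℝ³` is gapped-twelve at scale `a` (tolerance `1/50`, gap `63/50`).
`IsGappedTwelveAt X a N i = IsGappedTwelveFin a (X N) i` by `rfl` (example below). -/
def IsGappedTwelveFin (a : ℝ) {N : ℕ} (x : Fin N → E3) (i : Fin N) : Prop :=
  (Finset.univ.filter fun j : Fin N => j ≠ i ∧ dist (x i) (x j) ≤ a * (1 + 1 / 50)).card = 12 ∧
    ∀ j : Fin N, j ≠ i → a * (1 - 1 / 50) ≤ dist (x i) (x j) ∧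
      (dist (x i) (x j) ≤ a * (1 + 1 / 50) ∨ a * (63 / 50) ≤ dist (x i) (x j))

example (X : (N : ℕ) → (Fin N → E3)) (a : ℝ) (N : ℕ) (i : Fin N) :
    IsGappedTwelveAt X a N i = IsGappedTwelveFin a (X N) i := rfl

/-! ## Card A — layered scale lock -/

/-- The conclusion predicate of `PhononSlackCertificates.NearFieldConvexity` (stmt-13958), copied
verbatim: the radius-2 ball of `x i` is two-way `η`-matched, after a translation, to a LAYERED set
(rigid image of triangular layers of spacing `a ∈ [47/50,1]`, hole registry along a Hägg word,
free interlayer spacings in `[39a/50, 17a/20]`). -/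
def LayeredMatched (η : ℝ) {N : ℕ} (x : Fin N → E3) (i : Fin N) : Prop :=
  ∃ (A : E3 →ₗᵢ[ℝ] E3) (t : E3) (a : ℝ) (s : ℤ → ℤ) (z : ℤ → ℝ), 47 / 50 ≤ a ∧ a ≤ 1 ∧ IsHaggSeq s ∧
    (∀ m : ℤ, 39 / 50 * a ≤ z (m + 1) - z m ∧ z (m + 1) - z m ≤ 17 / 20 * a) ∧
    let S : Set E3 := {p | ∃ m i j : ℤ, p = A (((i : ℝ) • triangularVec₁ a) + ((j : ℝ) • triangularVec₂ a)
      + ((haggLabel s m : ℝ) • barlowOffset a) + (z m • layerNormal 1))};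
    (∀ j : Fin N, dist (x j) (x i) ≤ 2 → ∃ p ∈ S, dist (x j + t) p ≤ η) ∧
      (∀ p ∈ S, dist p (x i + t) ≤ 2 → ∃ j : Fin N, dist (x j + t) p ≤ η)

/-- **LayeredScaleLock** (Card A's new crux piece, perturbative): there is ONE scale
`a ∈ [47/50, 1]` (intended: the relaxed-hcp bond length `a* ≈ 0.9712`) and a matching tolerance
`η > 0` such that, for every separation `δ > 0`, in every ball `B(z, L)` all of whose sites out to
`L + 4` are `η`-layered-matched, the summed site excess pays `c` per site that is NOT gapped-twelve at
scale `a` (tolerance `1/50`, gap `63/50`), up to a surface term `C·L²` — uniformly in `L ≥ 1`.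
Mechanism: Cauchy–Born lower bound on `η`-perfect layered regions (CDKM06 / E–Ming / Schmidt discrete
rigidity) + strict convexity of the LAYERED lattice energy in the stiff variables (scale `a`,
interlayer spacings `z`) at the relaxed Barlow values, certified by interval lattice sums. -/
def LayeredScaleLock : Prop :=
  ∃ a : ℝ, 47 / 50 ≤ a ∧ a ≤ 1 ∧ ∃ η : ℝ, 0 < η ∧ ∀ δ : ℝ, 0 < δ → ∃ c : ℝ, 0 < c ∧ ∃ C : ℝ,
    ∀ L : ℝ, 1 ≤ L → ∀ (N : ℕ) (x : Fin N → E3), (∀ i j : Fin N, i ≠ j → δ ≤ dist (x i) (x j)) →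
      ∀ z : E3, (∀ i : Fin N, dist (x i) z ≤ L + 4 → LayeredMatched η x i) →
        c * (Nat.card {i : Fin N // dist (x i) z ≤ L ∧ ¬ IsGappedTwelveFin a x i} : ℝ) - C * L ^ 2
          ≤ ∑ i ∈ Finset.univ.filter (fun i => dist (x i) z ≤ L), siteExcess x i

/-- **Bridge A** (bookkeeping, M): coarse order from the sibling cruxes + the scale lock give the
crux.  `CoerciveTwoShellGap` (13956) ⇒ all but `(E(N) − N e*)/g = o(N)` sites are `1/20`-good;
`NearFieldConvexity` (13958) with `Ω =` good sites ⇒ all but `o(N)` sites are `η`-layered;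
cubes of side `L`: all but `o(N)·L³` sites lie in clean cubes; `LayeredScaleLock` on clean cubes
and `Σ_i siteExcess = E(N) − N e* = o(N)` (tree `crysEnergyLimit`) ⇒ `#radially-bad ≤ o(N) + C N/(cL)`
for every `L` ⇒ the crux (even with `∀ᶠ N`, at the single scale `a`). -/
def BridgeA : Prop :=
  CoerciveTwoShellGap → NearFieldConvexity → LayeredScaleLock → RadialDefectsVanish

/-! ## Card B — radial torus rigidity (flat tori suffice, radial & qualitative edition) -/

/-- Point `y` of the infinite set `Y` is gapped-twelve at scale `a` (the route's inline clause of
`CleanLocalLimit` / `FiveFoldRationing`). -/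
def IsGappedTwelveSet (a : ℝ) (Y : Set E3) (y : E3) : Prop :=
  {w ∈ Y | w ≠ y ∧ dist y w ≤ a * (1 + 1 / 50)}.ncard = 12 ∧
    ∀ w ∈ Y, w ≠ y → a * (1 - 1 / 50) ≤ dist y w ∧ (dist y w ≤ a * (1 + 1 / 50) ∨ a * (63 / 50) ≤ dist y w)

/-- **RadialTorusRigidity** (Card B's transfer `C⁺`, the open core in its weakest useful form): ONE
scale `a` such that NEAR-MINIMISING periodic configurations have few radially bad motif points —
for every `θ > 0` some `η > 0` works for every `δ`-separated periodic `P` with `e(P) ≤ e* + η`.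
Qualitative (no rate `g`), pattern-free, stacking-blind. -/
def RadialTorusRigidity : Prop :=
  ∃ a : ℝ, 47 / 50 ≤ a ∧ a ≤ 1 ∧ ∀ δ : ℝ, 0 < δ → ∀ θ : ℝ, 0 < θ → ∃ η : ℝ, 0 < η ∧
    ∀ P : PeriodicConfiguration 3, (∀ u ∈ P.points, ∀ v ∈ P.points, u ≠ v → δ ≤ dist u v) →
      P.energyPerParticle lennardJones ≤ eStar' + η →
        ((P.motif.filter fun y => ¬ IsGappedTwelveSet a P.points y).card : ℝ) ≤ θ * P.motif.card

/-- **VacuumPeriodisation** (Card B's first lemma, provable now, M): repeat a `δ`-separated finite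
configuration with a vacuum corridor of width `≥ 2` — the periodic energy per particle is at most
`E(x)/N` (copies interact only at distances `≥ 2 > 2^{-1/6}`, where `V_LJ < 0`), separation is kept,
and radial badness at every scale `a ≤ 1` is read identically in `x` and in `P.points` (status
depends on neighbours within `63a/50 < 2`). -/
def VacuumPeriodisation : Prop :=
  ∀ δ : ℝ, 0 < δ → ∀ (N : ℕ) (x : Fin N → E3), 0 < N → (∀ i j : Fin N, i ≠ j → δ ≤ dist (x i) (x j)) →
    ∃ P : PeriodicConfiguration 3, (∀ u ∈ P.points, ∀ v ∈ P.points, u ≠ v → min δ 2 ≤ dist u v) ∧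
      P.motif.card = N ∧ P.energyPerParticle lennardJones ≤ interactionEnergy lennardJones x / N ∧
      ∀ a : ℝ, 0 < a → a ≤ 1 →
        (P.motif.filter fun y => ¬ IsGappedTwelveSet a P.points y).card
          = Nat.card {i : Fin N // ¬ IsGappedTwelveFin a x i}

/-- **Bridge B** (bookkeeping, S/M given `VacuumPeriodisation`): ground states are `δ₀`-separated
(`LennardJonesMinimalDistance_holds`), `E(N)/N → e*` (`crysEnergyLimit`), so `e(P_N) ≤ E(N)/N ≤ e* + η`
eventually and `RadialTorusRigidity` bounds the bad count of `x^N` by `θN` eventually, a fortiori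
frequently, at the single scale `a`. -/
def BridgeB : Prop :=
  VacuumPeriodisation → RadialTorusRigidity → RadialDefectsVanish

/-! ## Card C — mean-shell rounding (averaged radial profile suffices) -/

/-- The strong thirteen-spheres theorem in THICK-SHELL form (named fact; Musin–Tarasov 2012,
`R₁₃ = 1.04557… > (51/50)/√((49/50)² − (1/25)²) = 1.04169`, by radial projection to the outer
sphere): at most twelve points with norms in `[49/50, 51/50]` and mutual distances `≥ 49/50`. -/
def StrongThirteenThick : Prop :=
  ∀ T : Finset E3, (∀ v ∈ T, (49 / 50 : ℝ) ≤ ‖v‖ ∧ ‖v‖ ≤ 51 / 50) →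
    (∀ v ∈ T, ∀ w ∈ T, v ≠ w → (49 / 50 : ℝ) ≤ dist v w) → T.card ≤ 12

/-- **MeanShellRounding** (Card C's first lemma, provable now from `StrongThirteenThick`, M): the
number of radially bad sites is controlled by THREE averaged pair counts — ordered pairs in the
short range `[0, 0.98a)`, in the annulus `(1.02a, 1.26a)`, and the deficit `12N − #(shell pairs)`. -/
def MeanShellRounding : Prop :=
  StrongThirteenThick → ∀ δ : ℝ, 0 < δ → ∃ C : ℝ, ∀ (N : ℕ) (x : Fin N → E3),
    (∀ i j : Fin N, i ≠ j → δ ≤ dist (x i) (x j)) → ∀ a : ℝ, 47 / 50 ≤ a → a ≤ 1 →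
      (Nat.card {i : Fin N // ¬ IsGappedTwelveFin a x i} : ℝ) ≤
        C * ((Finset.univ.filter fun p : Fin N × Fin N =>
                p.1 ≠ p.2 ∧ dist (x p.1) (x p.2) < a * (1 - 1 / 50)).card : ℝ)
        + C * ((Finset.univ.filter fun p : Fin N × Fin N =>
                a * (1 + 1 / 50) < dist (x p.1) (x p.2) ∧ dist (x p.1) (x p.2) < a * (63 / 50)).card : ℝ)
        + (12 * (N : ℝ) - ((Finset.univ.filter fun p : Fin N × Fin N =>
                p.1 ≠ p.2 ∧ a * (1 - 1 / 50) ≤ dist (x p.1) (x p.2) ∧ dist (x p.1) (x p.2) ≤ a * (1 + 1 / 50)).card : ℝ))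

/-- **AveragedRadialProfile** (Card C's transfer `C⁺`, crux-equivalent given `MeanShellRounding`):
at one scale `a`, frequently in `N`, the site-AVERAGED radial distribution of the ground state has
`≤ θ` short pairs and `≤ θ` annulus pairs per particle and mean shell coordination `≥ 12 − θ`. -/
def AveragedRadialProfile : Prop :=
  ∀ x : (N : ℕ) → (Fin N → E3), (∀ N, IsGroundState lennardJones (x N)) →
    ∃ a : ℝ, 47 / 50 ≤ a ∧ a ≤ 1 ∧ ∀ θ : ℝ, 0 < θ → ∃ᶠ N in Filter.atTop,
      ((Finset.univ.filter fun p : Fin N × Fin N =>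
          p.1 ≠ p.2 ∧ dist (x N p.1) (x N p.2) < a * (1 - 1 / 50)).card : ℝ) ≤ θ * N ∧
      ((Finset.univ.filter fun p : Fin N × Fin N =>
          a * (1 + 1 / 50) < dist (x N p.1) (x N p.2) ∧ dist (x N p.1) (x N p.2) < a * (63 / 50)).card : ℝ) ≤ θ * N ∧
      (12 - θ) * N ≤ ((Finset.univ.filter fun p : Fin N × Fin N =>
          p.1 ≠ p.2 ∧ a * (1 - 1 / 50) ≤ dist (x N p.1) (x N p.2) ∧ dist (x N p.1) (x N p.2) ≤ a * (1 + 1 / 50)).card : ℝ)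

/-- **Bridge C**: rounding turns averaged pair statistics into the crux. -/
def BridgeC : Prop :=
  StrongThirteenThick → MeanShellRounding → AveragedRadialProfile → RadialDefectsVanish

/-! ## Sanity: the three bridges type-check against the crux BY NAME. -/
example : BridgeA = (CoerciveTwoShellGap → NearFieldConvexity → LayeredScaleLock →
    Summit.AtomisticToContinuum.Crystallization.Theses.GappedShellCensus.RadialDefectsVanish) := rfl
example : BridgeB = (VacuumPeriodisation → RadialTorusRigidity →
    Summit.AtomisticToContinuum.Crystallization.Theses.GappedShellCensus.RadialDefectsVanish) := rfl

end Summit.AtomisticToContinuum.Crystallization.Cruxes.RadialDefectsVanish.IdeatorOne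

end
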